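-- PORTED from the prior programme stockroom (kernel-checked there, proofs untouched):
--   reserve/prior-2001/Prior/HodgeConjecture/HodgeConjecture/Hodge_WRankFourWeilFacesY1_Fock.lean
-- Changes: `import HarnessLib` dropped; outer namespace -> HodgeCM.Prior.Fock. Attribution: 2001 programme seats (docstrings).

import Mathlib

/-!
# Prior-program stockroom file `Hodge_WRankFourWeilFacesY1_Fock`

Imported from the 2001 program: `summits/hodge-w-rank-four-weil-faces/free/y1/lean/perl34/Common/Fock.lean` (commit a463a4c8cc18),
free `y1` of summit `hodge-w-rank-four-weil-faces`; prior STATUS `-`; imported 2026-08-13.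
Relevant to: Summit.HodgeConjecture.HodgeConjecture (the statement via the prior narrowed target `hodge-w-rank-four-weil-faces`); container free `y1`
Inspiration note: none (not a primary-summit route).
Existing Theses decls it bears on: not assessed at import (planners/provers decide; see reserve/prior-2001/README.md).
Mechanical changes only: provenance header, whole body wrapped in the namespace below (original namespaces nested
inside), stub docstrings on undocumented declarations, `#print`/`#check`/`#eval` lines dropped. Proofs untouched.
NOT part of the `lean/` tree: it enters `Summits/…/Theorems` only when a prover adapts it to a Theses decl (route item).
-/

namespace HodgeCM.Prior.Fock

/-
Common/Fock.lean — PERL34 shared Fock-model data types (CANONICAL definitions file).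

Programme: summits/hodge-w-rank-four-weil-faces/free/y1, PERL34-FORMALIZE-PLAN.md v2 (blob
e3be098b), item A3 dependencies.  Sources: [PerL] = PerL v5, git blob d912a121 (tex lines
cited per declaration); [Y1neg] = git blob 977557c2 (Lemma 3.1 = lem:F1, 3.2 = lem:F2).

CHECKER NOTE (sync discipline): kit/lean_check.py compiles one file at a time against the
warm mathlib workspace; sibling repo files cannot be `import`ed.  Consumer files
(S2/A3-statements.lean, ...) carry a VERBATIM copy of the definitions below, same names,
same namespace.  Any edit here must be mirrored there.  Definitions only; theorems live in
the per-item files.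
-/
namespace Perl34
namespace Fock

open MvPolynomial

/-- The submodule of polynomials supported on monomials satisfying `P`. -/
def monSupported {σ : Type*} (P : (σ →₀ ℕ) → Prop) : Submodule ℂ (MvPolynomial σ ℂ) where
  carrier := {p | ∀ m ∈ p.support, P m}
  add_mem' := by
    intro p q hp hq m hm
    classical
    rcases Finset.mem_union.mp (MvPolynomial.support_add hm) with h | h
    · exact hp m h
    · exact hq m h
  zero_mem' := by intro m hm; simp at hm
  smul_mem' := by intro c p hp m hm; exact hp m (MvPolynomial.support_smul hm)

/-! ### The plane Fock model at the noncompact place `ι₁`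
[PerL] l.505: `F_{ι₁} = ℂ[z_{aj}, w_j]`, `a, j ∈ {1,2}`; `a` = `U(2)_V`-index (row),
`j` = `W`-index (column). -/

/-- Variable index of the plane model: `inl (a, j)` is `z_{aj}`, `inr j` is `w_j`. -/
abbrev PlaneVar : Type := (Fin 2 × Fin 2) ⊕ Fin 2

/-- The plane Fock model at `ι₁` (polynomial part). [PerL] l.505. -/
abbrev PlaneModel : Type := MvPolynomial PlaneVar ℂ

/-- The variable `z_{aj}`. -/
noncomputable def z (a j : Fin 2) : PlaneModel := X (Sum.inl (a, j))

/-- The variable `w_j`. -/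
noncomputable def w (j : Fin 2) : PlaneModel := X (Sum.inr j)

/-- A `K_V = U(2) × U(1)`-weight, written `(k₁, k₂; k₃)` in the sources. -/
abbrev KVWeight : Type := ℤ × ℤ × ℤ

/-- Row sum `row_a A` of the `z`-exponent matrix of a monomial. -/
def zRow (m : PlaneVar →₀ ℕ) (a : Fin 2) : ℕ := ∑ j : Fin 2, m (Sum.inl (a, j))

/-- Total `w`-degree `|E|` of a monomial. -/
def wDeg (m : PlaneVar →₀ ℕ) : ℕ := ∑ j : Fin 2, m (Sum.inr j)

/-- `K_V`-weight of `z^A w^E` in the plane model with vacuum weight `ν` (EXPLICIT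
parameter, plan A3(i)/A#1): `(ν₁ + row₁ A, ν₂ + row₂ A; ν₃ − |E|)`.  [PerL] l.505–506 is
the case `ν = (0,0,−2)`: "K_V-weight of z^A w^E equal to (row sums of A; −2−|E|)
(vacuum (0,0;−2))". -/
def kvWt (ν : KVWeight) (m : PlaneVar →₀ ℕ) : KVWeight :=
  (ν.1 + (zRow m 0 : ℤ), ν.2.1 + (zRow m 1 : ℤ), ν.2.2 - (wDeg m : ℤ))

/-- The `K_V`-type `κ = (1,1;−2)` (weights of `∧²V⁺ ⊗ (V⁻)^{⊗2∨}`). [PerL] l.506. -/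
def kappa : KVWeight := (1, 1, -2)

/-- The `κ`-weight space of the plane model with vacuum `ν`. -/
def weightSpace (ν κ : KVWeight) : Submodule ℂ PlaneModel :=
  monSupported (fun m => kvWt ν m = κ)

/-- `det z = z_{11}z_{22} − z_{12}z_{21}` (0-indexed here). [PerL] l.509–510. -/
noncomputable def detZ : PlaneModel := z 0 0 * z 1 1 - z 0 1 * z 1 0

/-- `U(2)_V` raising operator `E₊ = Σ_j z_{1j} ∂/∂z_{2j}` (root `e₁ − e₂`; 0-indexed:
row 1 → row 0).  Root operators are unaffected by the vacuum character twist. -/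
noncomputable def Eplus : PlaneModel →ₗ[ℂ] PlaneModel :=
  ∑ j : Fin 2, (LinearMap.mulLeft ℂ (z 0 j)).comp (pderiv (Sum.inl (1, j))).toLinearMap

/-- `U(2)_V` lowering operator `E₋ = Σ_j z_{2j} ∂/∂z_{1j}`. -/
noncomputable def Eminus : PlaneModel →ₗ[ℂ] PlaneModel :=
  ∑ j : Fin 2, (LinearMap.mulLeft ℂ (z 1 j)).comp (pderiv (Sum.inl (0, j))).toLinearMap

/-- The (infinitesimal) `κ`-part of the plane model with vacuum `ν`: the `κ`-weight space
intersected with the joint kernel of both root operators — the weight-level formalisation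
of "`U(2)_V`-invariants twisted by `det`" ([PerL] l.508–509): a weight-`(1,1)` vector
spans a `det`-character line for `U(2)_V` iff `𝔰𝔩₂(V)` kills it. -/
noncomputable def kappaPart (ν : KVWeight) : Submodule ℂ PlaneModel :=
  weightSpace ν kappa ⊓ LinearMap.ker Eplus ⊓ LinearMap.ker Eminus

/-- `(12)`-adapted `W`-torus substitution: `(u₁,u₂)` acts by `z_{aj} ↦ u_j z_{aj}`,
`w_j ↦ u_j^{-1} w_j` ([Y1neg] l.113, per line factor; vacuum character bookkept
separately, [PerL] l.510 "times the vacuum character"). -/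
noncomputable def torusSubst (u : Fin 2 → ℂˣ) : PlaneModel →ₐ[ℂ] PlaneModel :=
  aeval (fun v => match v with
    | Sum.inl (a, j) => (u j : ℂ) • z a j
    | Sum.inr j => (((u j)⁻¹ : ℂˣ) : ℂ) • w j)

/-- Column base change `g` on the `W`-index of the `z`-variables: `z_{aj} ↦ Σ_k z_{ak}
g_{kj}` (`w` untouched; only the `z`-column transformation of `det z` is consumed:
[PerL] l.512–513, "`det(z)` changes by the scalar `det` of the base change"). -/
noncomputable def columnSubst (g : Matrix (Fin 2) (Fin 2) ℂ) : PlaneModel →ₐ[ℂ] PlaneModel :=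
  aeval (fun v => match v with
    | Sum.inl (a, j) => ∑ k : Fin 2, g k j • z a k
    | Sum.inr j => w j)

/-! ### The line Fock model at `ι₁` (`(p,q) = (2,1)`)
[Y1neg] l.113; [PerL] l.364–365: `ℂ[z₁, z₂, w]`. -/

/-- Variable index of the line model: `inl a` = `z_a`, `inr ()` = `w`. -/
abbrev LineVar : Type := Fin 2 ⊕ Unit

/-- The line Fock model (polynomial part). -/
abbrev LineModel : Type := MvPolynomial LineVar ℂ

/-- The variable `z_a`. -/
noncomputable def lz (a : Fin 2) : LineModel := X (Sum.inl a)

/-- The variable `w`. -/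
noncomputable def lw : LineModel := X (Sum.inr ())

/-- `U(1) = U(W)`-weight (polynomial part) of a line monomial `z^a w^e`: `|a| − e`
(`u·z_a = u z_a`, `u·w = u⁻¹w`; vacuum character bookkept separately). [Y1neg] l.113. -/
def u1wt (m : LineVar →₀ ℕ) : ℤ :=
  (∑ a : Fin 2, (m (Sum.inl a) : ℤ)) - (m (Sum.inr ()) : ℤ)

/-- Total `z`-degree `|a|` of a line monomial. -/
def lzDeg (m : LineVar →₀ ℕ) : ℕ := ∑ a : Fin 2, m (Sum.inl a)

/-- `U(1)_V`-weight (third `K_V`-coordinate) of a line monomial in the `α = 0`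
normalisation selected by [Y1neg] Lemma 3.1(a) (vacuum `(α,α;α−1)`, `α = 0`):
`−1 − e` on `z^a w^e`. -/
def vWt (m : LineVar →₀ ℕ) : ℤ := -1 - (m (Sum.inr ()) : ℤ)

/-- The `J⁺` ladder: span of `{z^a w^e : |a| = e + 1}` = the `U(1)`-weight-1 part.
[PerL] l.364–365. -/
def ladder : Submodule ℂ LineModel := monSupported (fun m => u1wt m = 1)

/-! ### The definite-place mixed-sign model (case (iii))
[PerL] l.501–505: `ℂ[z₁,z₂,z₃,w₁,w₂,w₃]`, `U(3)` standard on `z`, dual on `w`. -/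

/-- Variable index: `inl a` = `z_a`, `inr a` = `w_a`, `a ∈ Fin 3`. -/
abbrev MixedVar : Type := Fin 3 ⊕ Fin 3

/-- The mixed-sign model (polynomial part). -/
abbrev MixedModel : Type := MvPolynomial MixedVar ℂ

/-- The variable `z_a`. -/
noncomputable def mz (a : Fin 3) : MixedModel := X (Sum.inl a)

/-- The variable `w_a`. -/
noncomputable def mw (a : Fin 3) : MixedModel := X (Sum.inr a)

/-- The basic invariant `P = Σ_a z_a w_a`. [PerL] l.502. -/
noncomputable def Pinv : MixedModel := ∑ a : Fin 3, mz a * mw a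

/-- The quadratic torus invariants `u_a := z_a w_a`. -/
noncomputable def uInv (a : Fin 3) : MixedModel := mz a * mw a

/-- Substitution attached to `g ∈ M₃(ℂ)`: `z_a ↦ Σ_b g_{ab} z_b`, `w_a ↦ Σ_b conj(g_{ab})
w_b`.  For UNITARY `g` this is the honest `U(3)`-action on `V ⊕ V^∨` (`(gᵗ)⁻¹ = conj g`
when `gᴴg = 1`); it is defined for all `g` but only consumed on unitary `g`. -/
noncomputable def mixedSubst (g : Matrix (Fin 3) (Fin 3) ℂ) : MixedModel →ₐ[ℂ] MixedModel :=
  aeval (fun v => match v with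
    | Sum.inl a => ∑ b : Fin 3, g a b • mz b
    | Sum.inr a => ∑ b : Fin 3, (starRingEnd ℂ) (g a b) • mw b)

/-- `U(3)`-invariance in the mixed model: fixed by `mixedSubst g` for every unitary `g`.
[PerL] l.501–502 "invariants". -/
def MixedInvariant (p : MixedModel) : Prop :=
  ∀ g : Matrix (Fin 3) (Fin 3) ℂ, g ∈ unitary (Matrix (Fin 3) (Fin 3) ℂ) → mixedSubst g p = p

/-- A mixed monomial is balanced: each `z_a`-degree equals the corresponding
`w_a`-degree. -/
def Balanced (m : MixedVar →₀ ℕ) : Prop := ∀ a : Fin 3, m (Sum.inl a) = m (Sum.inr a)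

/-! ### Equal-sign definite-place model (case (ii))
[PerL] l.499–500: `ℂ[M_{3×2}]`, `U(3)` by the standard representation on both columns. -/

/-- The equal-sign model: polynomials on `M_{3×2}`. -/
abbrev EqModel : Type := MvPolynomial (Fin 3 × Fin 2) ℂ

/-- Central scaling `λ` of `U(3)` on the equal-sign model: every variable `↦ λ·`. -/
noncomputable def eqScale (lam : ℂ) : EqModel →ₐ[ℂ] EqModel :=
  aeval (fun v => C lam * X v)

/-! ### Sign bookkeeping at the definite places ([Y1neg] Lemma 3.2 = lem:F2; [PerL]
l.472–478, 496–499).  The vacuum `det`-exponent of the `(3,0)`-line model is affine of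
slope `1/2` in the splitting exponent `m`: `α'_c(m) = (m + c)/2`, `c` a fixed ODD
normalisation constant (`c = 1` in the HKS normalisation, [Y1neg] l.126).  Over `ℤ`,
`α'_c(m) = 0` is rendered `m + c = 0` (exact: `c` odd forces `m` odd). -/

/-- Sign of a real hermitian line; `true` = positive. -/
abbrev Sign : Type := Bool

/-- `occursTrivial c s m`: the trivial `U(3)`-type occurs in the sign-`s` line model with
splitting exponent `m` (vacuum `det`-exponent vanishes).  Positive line: `α'_c(m) = 0`;
negative line: the model is the conjugate one with exponent `−m` ([Y1neg] l.126 proof,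
[PerL] l.496–499), so `α'_c(−m) = 0`. -/
def occursTrivial (c : ℤ) (s : Sign) (m : ℤ) : Prop :=
  if s then m + c = 0 else -m + c = 0

/-- The unique splitting exponent with trivial vacuum character, per sign:
`mSign c (+) = −c`, `mSign c (−) = c`.  HKS pin `c = 1`: `m(+) = −1`, `m(−) = +1`
([Y1neg] l.126 last sentence). -/
def mSign (c : ℤ) (s : Sign) : ℤ := if s then -c else c

end Fock
end Perl34



end HodgeCM.Prior.Fock
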